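import Summits.QuantumFields.YangMills.Theorems.ToronValleyVolumeZeroModeKernel

/-!
# Zero-mode quartic of the toron valley, V: bounds on the conditional integrals `Φ±(β, r e₃)`

(U1) `Φ⁺(β,a) ≤ exp(−‖a‖²/2)·vol(B̄_{‖a‖})³`; (U2) `Φ⁺(β, re₃) ≤ exp(−r²/2)·K/(rβ)³` (drop the planar 2×2 Gram term, relax the
ball to the slab `|x_μ,2| ≤ r`, rescale `p = q/(r√β)`, `z = rw` — the image is exactly `κ`);
(L) `Φ⁻(β, re₃) ≥ exp(−2r₁²)(1−θ)³ L_M/(rβ)³` for `r ≤ r₁`, `βr⁴ ≥ (M+1)⁴/θ²` (restrict to `|z_μ| ≤ (1−θ)r`, `|p_μ| ≤ (M+1)/(r√β)`,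
bound the Gram term by `|p_μ|²|p_ν|²`; the image dominates `λ_M`).

HONEST LABEL: helper analysis for a plan-only BC5 rung (`stub_rung_zeroModeLog4`) of crux ⟨stmt-QuantumFields-24497⟩ on a
DRAFT-by-design sub-route (`ToronValleyVolume`, LINE g15-B of ym-idea-4); it is NOT in the crux composition; no crux, rung of the
ladder, leaf or summit statement is proved here; the Yang–Mills mass gap is NOT proved by this.
-/

noncomputable section

namespace Summit.QuantumFields.YangMills.Theorems.ToronValleyVolume.ZeroMode

open MeasureTheory Real Finset Set
open scoped ENNReal
open Summit.QuantumFields.YangMills.Cruxes.ToronTubeVolumeLaw.Birth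

/-! ## §9 Bounds on the conditional integrals `Φ±(β, r e₃)` -/

/-- `‖r • e₃‖ = r` for `r ≥ 0`. -/
theorem norm_smul_e3 {r : ℝ} (hr : 0 ≤ r) : ‖(r • e3 : EuclideanSpace ℝ (Fin 3))‖ = r := by
  rw [norm_smul, norm_e3, mul_one, Real.norm_eq_abs, abs_of_nonneg hr]

/-- The split integrand is bounded by `exp(−‖a‖²/2)`. -/
theorem zmI_four_snoc_le {β : ℝ} (hβ : 0 ≤ β) (x : Fin 3 → EuclideanSpace ℝ (Fin 3)) (a : EuclideanSpace ℝ (Fin 3)) :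
    zmI 4 β (Fin.snoc x a) ≤ Real.exp (-‖a‖ ^ 2 / 2) := by
  rw [zmI_four_snoc]
  refine Real.exp_le_exp.2 ?_
  have h1 : 0 ≤ zeroModeQuartic 3 x + ∑ μ, pd (x μ) a :=
    add_nonneg (quartic_nonneg 3 x) (Finset.sum_nonneg fun μ _ => pd_nonneg _ _)
  have h2 : 0 ≤ ∑ μ, ‖x μ‖ ^ 2 := Finset.sum_nonneg fun μ _ => sq_nonneg _
  have h3 := mul_nonneg hβ h1
  rw [neg_div]; linarith

/-- `boxLe a` is the product of closed balls. -/
theorem boxLe_eq_pi (a : EuclideanSpace ℝ (Fin 3)) :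
    boxLe a = Set.univ.pi fun _ : Fin 3 => Metric.closedBall (0 : EuclideanSpace ℝ (Fin 3)) ‖a‖ := by
  ext x; simp [boxLe]

/-- (U1) VOLUME BOUND: `Φ⁺(β,a) ≤ exp(−‖a‖²/2) · vol(B̄_{‖a‖})³`. -/
theorem PhiP_le_volume {β : ℝ} (hβ : 0 ≤ β) (a : EuclideanSpace ℝ (Fin 3)) :
    PhiP β a ≤ ENNReal.ofReal (Real.exp (-‖a‖ ^ 2 / 2)) *
      volume (Metric.closedBall (0 : EuclideanSpace ℝ (Fin 3)) ‖a‖) ^ 3 := by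
  unfold PhiP
  calc ∫⁻ x, (boxLe a).indicator (G4 β a) x
      ≤ ∫⁻ x, (boxLe a).indicator (fun _ => ENNReal.ofReal (Real.exp (-‖a‖ ^ 2 / 2))) x := by
        refine lintegral_mono fun x => indicator_le_indicator' fun _ => ?_
        exact ENNReal.ofReal_le_ofReal (zmI_four_snoc_le hβ x a)
    _ = ENNReal.ofReal (Real.exp (-‖a‖ ^ 2 / 2)) * volume (boxLe a) := by
        rw [lintegral_indicator (measurableSet_boxLe a), setLIntegral_const]
    _ = _ := by rw [boxLe_eq_pi, volume_pi_pi, Fin.prod_const]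

/-- Pointwise UPPER comparison at `a = r e₃` (`β, r > 0`): the box integrand is dominated by
`exp(−r²/2) · κ(Λ x)` with `Λ = Λ(r√β, 1/r)`. -/
theorem indicator_G4_le_kappa {β r : ℝ} (hβ : 0 < β) (hr : 0 < r) (x : Fin 3 → EuclideanSpace ℝ (Fin 3)) :
    (boxLe (r • e3)).indicator (G4 β (r • e3)) x ≤
      ENNReal.ofReal (Real.exp (-r ^ 2 / 2)) * kappa (Lam (r * Real.sqrt β) r⁻¹ x) := by
  by_cases hx : x ∈ boxLe (r • e3)
  · rw [indicator_of_mem hx]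
    have hslab : Lam (r * Real.sqrt β) r⁻¹ x ∈ slab := by
      intro μ
      rw [Lam_apply, diag3_apply_two, abs_mul, abs_inv, abs_of_pos hr]
      have h1 : |x μ 2| ≤ r := (abs_coord_le_norm (x μ) 2).trans (by simpa [norm_smul_e3 hr.le] using hx μ)
      rw [inv_mul_le_iff₀ hr]; linarith
    unfold kappa; rw [indicator_of_mem hslab, ← ENNReal.ofReal_mul (Real.exp_pos _).le]
    refine ENNReal.ofReal_le_ofReal ?_
    unfold kerR
    rw [zmI_four_snoc, ← Real.exp_add, plSum_Lam, crSum_Lam, sum_pd_smul_e3, norm_smul_e3 hr.le]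
    refine Real.exp_le_exp.2 ?_
    have hs : (r * Real.sqrt β) ^ 2 = r ^ 2 * β := by rw [mul_pow, Real.sq_sqrt hβ.le]
    rw [hs, show r ^ 2 * β * r⁻¹ ^ 2 = β by field_simp]
    have h1 := crSum_le_quartic x
    have h2 : 0 ≤ ∑ μ, ‖x μ‖ ^ 2 := Finset.sum_nonneg fun μ _ => sq_nonneg _
    have h3 : 0 ≤ plSum x := plSum_nonneg x
    nlinarith [mul_le_mul_of_nonneg_left h1 hβ.le, mul_nonneg hβ.le h3]
  · rw [indicator_of_notMem hx]; exact zero_le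

/-- (U2) KERNEL BOUND: `Φ⁺(β, r e₃) ≤ exp(−r²/2) · (rβ)⁻³ · K` for `β, r > 0`. -/
theorem PhiP_le_kernel {β r : ℝ} (hβ : 0 < β) (hr : 0 < r) :
    PhiP β (r • e3) ≤ ENNReal.ofReal (Real.exp (-r ^ 2 / 2)) * ENNReal.ofReal (((r * β) ^ 3)⁻¹) * KK := by
  have hs : r * Real.sqrt β ≠ 0 := mul_ne_zero hr.ne' (Real.sqrt_pos.2 hβ).ne'
  have ht : r⁻¹ ≠ 0 := inv_ne_zero hr.ne'
  unfold PhiP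
  calc ∫⁻ x, (boxLe (r • e3)).indicator (G4 β (r • e3)) x
      ≤ ∫⁻ x, ENNReal.ofReal (Real.exp (-r ^ 2 / 2)) * kappa (Lam (r * Real.sqrt β) r⁻¹ x) :=
        lintegral_mono fun x => indicator_G4_le_kappa hβ hr x
    _ = ENNReal.ofReal (Real.exp (-r ^ 2 / 2)) * ∫⁻ x, kappa (Lam (r * Real.sqrt β) r⁻¹ x) := by
        rw [lintegral_const_mul]
        exact measurable_kappa.comp (LinearMap.continuous_of_finiteDimensional _).measurable
    _ = ENNReal.ofReal (Real.exp (-r ^ 2 / 2)) * (ENNReal.ofReal (((r * β) ^ 3)⁻¹) * KK) := by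
        rw [lintegral_comp_Lam hs ht _ measurable_kappa]
        unfold KK
        congr 3
        have : (r * Real.sqrt β) * (r * Real.sqrt β) * r⁻¹ = r * β := by
          have := Real.mul_self_sqrt hβ.le
          field_simp
          nlinarith [this]
        rw [this, abs_of_pos (by positivity)]
    _ = _ := by rw [mul_assoc]

/-- Pointwise LOWER comparison at `a = r e₃`: for `β, r > 0`, `r ≤ r₁`, `0 < θ ≤ 1/2`, `M` with
`β r⁴ ≥ (M+1)⁴/θ²`, the strict-box integrand dominates `exp(−2r₁²) · λ_M(Λ' x)`, `Λ' = Λ(r√β, 1/((1−θ)r))`. -/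
theorem lam_le_indicator_G4 {β r r₁ θ : ℝ} (hβ : 0 < β) (hr : 0 < r) (hr₁ : r ≤ r₁) (hθ : 0 < θ) (hθ1 : θ ≤ 1 / 2)
    (M : ℕ) (hM : ((M : ℝ) + 1) ^ 4 / θ ^ 2 ≤ β * r ^ 4) (x : Fin 3 → EuclideanSpace ℝ (Fin 3)) :
    ENNReal.ofReal (Real.exp (-(2 * r₁ ^ 2))) * lam M (Lam (r * Real.sqrt β) ((1 - θ) * r)⁻¹ x) ≤
      (boxLt (r • e3)).indicator (G4 β (r • e3)) x := by
  have hm1 : (1 : ℝ) ≤ (M : ℝ) + 1 := by linarith [(Nat.cast_nonneg M : (0 : ℝ) ≤ M)]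
  have hθ' : 0 < 1 - θ := by linarith
  by_cases hx : Lam (r * Real.sqrt β) ((1 - θ) * r)⁻¹ x ∈ slabBall M
  · -- unpack the truncated-slab membership
    have hs2 : (r * Real.sqrt β) ^ 2 = r ^ 2 * β := by rw [mul_pow, Real.sq_sqrt hβ.le]
    have hM' : ((M : ℝ) + 1) ^ 4 ≤ θ ^ 2 * (β * r ^ 4) := by
      have := (div_le_iff₀ (by positivity : (0 : ℝ) < θ ^ 2)).1 hM; linarith
    have hz : ∀ μ, |x μ 2| ≤ (1 - θ) * r := by
      intro μ
      have := (hx μ).1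
      rw [Lam_apply, diag3_apply_two, abs_mul, abs_inv, abs_of_pos (by positivity)] at this
      rwa [inv_mul_le_iff₀ (by positivity), mul_one] at this
    have hp : ∀ μ, plSq (x μ) ≤ θ ^ 2 * r ^ 2 := by
      intro μ
      have h1 := (hx μ).2
      rw [Lam_apply, plSq_diag3, hs2] at h1
      -- `r²β · plSq ≤ m²` and `m² ≤ m⁴ ≤ θ² r⁴ β`
      have hm4 : ((M : ℝ) + 1) ^ 2 ≤ ((M : ℝ) + 1) ^ 4 := by
        have h1 : 1 ≤ ((M : ℝ) + 1) ^ 2 := one_le_pow₀ hm1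
        nlinarith [h1]
      have hrb : 0 < r ^ 2 * β := by positivity
      by_contra hcon
      push Not at hcon
      have : r ^ 2 * β * (θ ^ 2 * r ^ 2) < r ^ 2 * β * plSq (x μ) := mul_lt_mul_of_pos_left hcon hrb
      nlinarith
    -- hence strictly inside the ball of radius `r`
    have hnorm : ∀ μ, ‖x μ‖ ^ 2 < r ^ 2 := by
      intro μ
      rw [normSq_eq_plSq_add]
      have h2 : x μ 2 ^ 2 ≤ ((1 - θ) * r) ^ 2 := by
        calc x μ 2 ^ 2 = |x μ 2| ^ 2 := (sq_abs _).symm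
          _ ≤ ((1 - θ) * r) ^ 2 := pow_le_pow_left₀ (abs_nonneg _) (hz μ) 2
      have h4 : θ ^ 2 + (1 - θ) ^ 2 < 1 := by nlinarith
      have h5 : 0 < (1 - (θ ^ 2 + (1 - θ) ^ 2)) * r ^ 2 := mul_pos (by linarith) (pow_pos hr 2)
      nlinarith [hp μ, h2, h5]
    have hball : x ∈ boxLt (r • e3) := by
      intro μ
      rw [norm_smul_e3 hr.le]
      exact abs_norm (x μ) ▸ abs_lt_of_sq_lt_sq (hnorm μ) hr.le
    rw [indicator_of_mem hball]
    unfold lam; rw [indicator_of_mem hx, ← ENNReal.ofReal_mul (Real.exp_pos _).le]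
    refine ENNReal.ofReal_le_ofReal ?_
    unfold lamR
    rw [zmI_four_snoc, ← Real.exp_add, plSum_Lam, crSum_Lam, sum_pd_smul_e3, norm_smul_e3 hr.le, hs2,
      show r ^ 2 * β * ((1 - θ) * r)⁻¹ ^ 2 = β / (1 - θ) ^ 2 by field_simp]
    refine Real.exp_le_exp.2 ?_
    -- the three comparisons
    have hq := quartic_le_plSum_sq_add_crSum x
    have hcr := crSum_nonneg x
    have hpl := plSum_nonneg x
    have hsum : ∑ μ, ‖x μ‖ ^ 2 ≤ 3 * r ^ 2 := by
      calc ∑ μ, ‖x μ‖ ^ 2 ≤ ∑ μ : Fin 3, r ^ 2 := Finset.sum_le_sum fun μ _ => (hnorm μ).le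
        _ = 3 * r ^ 2 := by simp
    have hr1sq : r ^ 2 ≤ r₁ ^ 2 := pow_le_pow_left₀ hr.le hr₁ 2
    have e1 : β * crSum x ≤ β / (1 - θ) ^ 2 * crSum x := by
      refine mul_le_mul_of_nonneg_right ?_ hcr
      rw [le_div_iff₀ (by positivity)]
      have : (1 - θ) ^ 2 ≤ 1 := by nlinarith
      nlinarith [mul_le_mul_of_nonneg_left this hβ.le]
    have e2 : β * ((1 / 2) * plSum x ^ 2) ≤ (r ^ 2 * β * plSum x) ^ 2 / (2 * ((M : ℝ) + 1) ^ 4) := by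
      -- `β ≤ (r²β)²/m⁴` from `m⁴ ≤ θ² β r⁴ ≤ β r⁴`
      have hθ2 : θ ^ 2 ≤ 1 := by nlinarith
      have hm4 : ((M : ℝ) + 1) ^ 4 ≤ β * r ^ 4 := by
        nlinarith [hM', hθ2, show 0 ≤ β * r ^ 4 by positivity]
      rw [le_div_iff₀ (by positivity)]
      have h0 : 0 ≤ β * plSum x ^ 2 := by positivity
      calc β * (1 / 2 * plSum x ^ 2) * (2 * ((M : ℝ) + 1) ^ 4) = (β * plSum x ^ 2) * ((M : ℝ) + 1) ^ 4 := by ring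
        _ ≤ (β * plSum x ^ 2) * (β * r ^ 4) := mul_le_mul_of_nonneg_left hm4 h0
        _ = (r ^ 2 * β * plSum x) ^ 2 := by ring
    have e3' : β * zeroModeQuartic 3 x ≤ β * ((1 / 2) * plSum x ^ 2 + crSum x) :=
      mul_le_mul_of_nonneg_left hq hβ.le
    nlinarith [e1, e2, e3', hsum, hr1sq]
  · unfold lam; rw [indicator_of_notMem hx, mul_zero]; exact zero_le

/-- (L) LOWER KERNEL BOUND: `Φ⁻(β, r e₃) ≥ exp(−2r₁²) · (1−θ)³ (rβ)⁻³ · L_M` under the same hypotheses. -/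
theorem kernel_le_PhiM {β r r₁ θ : ℝ} (hβ : 0 < β) (hr : 0 < r) (hr₁ : r ≤ r₁) (hθ : 0 < θ) (hθ1 : θ ≤ 1 / 2)
    (M : ℕ) (hM : ((M : ℝ) + 1) ^ 4 / θ ^ 2 ≤ β * r ^ 4) :
    ENNReal.ofReal (Real.exp (-(2 * r₁ ^ 2))) * ENNReal.ofReal ((1 - θ) ^ 3 * ((r * β) ^ 3)⁻¹) * LL M ≤
      PhiM β (r • e3) := by
  have hθ' : 0 < 1 - θ := by linarith
  have hs : r * Real.sqrt β ≠ 0 := mul_ne_zero hr.ne' (Real.sqrt_pos.2 hβ).ne'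
  have ht : ((1 - θ) * r)⁻¹ ≠ 0 := inv_ne_zero (mul_ne_zero hθ'.ne' hr.ne')
  unfold PhiM
  calc ENNReal.ofReal (Real.exp (-(2 * r₁ ^ 2))) * ENNReal.ofReal ((1 - θ) ^ 3 * ((r * β) ^ 3)⁻¹) * LL M
      = ENNReal.ofReal (Real.exp (-(2 * r₁ ^ 2))) *
          ∫⁻ x, lam M (Lam (r * Real.sqrt β) ((1 - θ) * r)⁻¹ x) := by
        rw [lintegral_comp_Lam hs ht _ (measurable_lam M), mul_assoc]
        unfold LL
        congr 3
        have hsq := Real.mul_self_sqrt hβ.le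
        have : (r * Real.sqrt β) * (r * Real.sqrt β) * ((1 - θ) * r)⁻¹ = r * β / (1 - θ) := by
          field_simp
          nlinarith [hsq]
        rw [this, abs_of_pos (by positivity)]
        field_simp
    _ = ∫⁻ x, ENNReal.ofReal (Real.exp (-(2 * r₁ ^ 2))) * lam M (Lam (r * Real.sqrt β) ((1 - θ) * r)⁻¹ x) := by
        rw [lintegral_const_mul]
        exact (measurable_lam M).comp (LinearMap.continuous_of_finiteDimensional _).measurable
    _ ≤ ∫⁻ x, (boxLt (r • e3)).indicator (G4 β (r • e3)) x :=
        lintegral_mono fun x => lam_le_indicator_G4 hβ hr hr₁ hθ hθ1 M hM x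


end Summit.QuantumFields.YangMills.Theorems.ToronValleyVolume.ZeroMode

end
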